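import Summits.CriticalPhenomena.PercolationContinuityZ3.Theses.PercNonProliferation
import Literature.Probability.Percolation.KozmaNitzanTargetLemma
import Literature.Probability.Percolation.CerfUniquenessZoneBound

/-!
# Sketch — crux idea `uniqueness-zone-segregation` (crux stmt-CriticalPhenomena-4445,
# `PercNonProliferation.FreeBoxSparse`; crux-ideate round 2, ideator 4)

First-lemma vocabulary and typed statements (Props only; nothing is proved here).

Lever: the PROVED uniqueness-zone bound `AKN.dkt_prop1` (Duminil-Copin–Kozma–Tassion 2020 Prop. 1 =
Cerf 2015 Thm 1.2 with a rate, BOND percolation, uniform in `p ∈ [δ, 1-δ]`):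
`P_p((uniqZone ⌊n^α⌋ n)ᶜ) ≤ n^{-α}` — two distinct clusters of `Λ_n` both joining `Λ_{⌊n^α⌋}` to
`∂Λ_n` are polynomially rare — turned, by a translation-averaged FIRST MOMENT over a grid of
`w`-cubes placed at the MIXING SCALE of two dense pieces, into

* `GridTwoArmsCount` (deterministic): if two `a`-dense pieces of `Λ_n`, distinct inside `Λ_{2n}`,
  are `w`-mixed (an `η`-fraction of one lies within sup-distance `w` of the other) then at least
  `η a |Λ_n| / (2w+1)³` grid cubes `c + Λ_w` see the two-cluster event `(uniqZoneAt c (2w) L)ᶜ`;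
* `UniquenessZoneSegregation` (the first lemma of the line): at `p_c` (indeed uniformly in
  `p ∈ [δ,1-δ]`), for every density `a` and fraction `η`, `w`-mixed dense distinct pairs with
  `w = ⌊n^α⌋` have probability `O(n^{-α})` — two distinct dense free pieces are SEGREGATED at every
  scale up to `n^α`: all but a vanishing fraction of each lies at sup-distance `> n^α` from the other.
-/

noncomputable section

open MeasureTheory Filter Topology
open Literature.Probability.Percolation Literature.Probability.LatticeModels
open scoped Classical

namespace Summit.CriticalPhenomena.PercolationContinuityZ3.Cruxes.FreeBoxSparse.SketchIdeator4

/-- Sites of `ℤ³`. -/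
abbrev V3 : Type := Site 3

/-- `P_p` on `ℤ³`. -/
abbrev μ (p : unitInterval) : Measure (BondConfig V3) := bondPercolation (zdGraph 3) p

/-- `|C_Λ(x)|`: number of sites of `Λ` joined to `x` by an open path inside `Λ` (the free piece of
`x` in `Λ`; `0` if `x ∉ Λ`). -/
def pieceCard (Λ : Finset V3) (ω : BondConfig V3) (x : V3) : ℕ :=
  (Λ.filter fun v => ω ∈ openConnIn (↑Λ : Set V3) x v).card

/-- `x` is `a`-dense in `Λ`: its free piece has at least `a |Λ|` sites. -/
def IsDenseIn (a : ℝ) (Λ : Finset V3) (ω : BondConfig V3) (x : V3) : Prop :=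
  a * (Λ.card : ℝ) ≤ (pieceCard Λ ω x : ℝ)

/-- Number of sites of the free piece of `x'` in `Λ` lying within sup-distance `w` of the free piece
of `x` in `Λ` (the `w`-contact mass of `C_Λ(x')` against `C_Λ(x)`). -/
def nearCard (Λ : Finset V3) (ω : BondConfig V3) (x x' : V3) (w : ℕ) : ℕ :=
  (Λ.filter fun v => ω ∈ openConnIn (↑Λ : Set V3) x' v ∧
    ∃ u ∈ Λ, ω ∈ openConnIn (↑Λ : Set V3) x u ∧ u - v ∈ box 3 w).card

/-- **`w`-MIXED DENSE DISTINCT PAIR** in `Λ_n`: two sites `x, x'` of `Λ_n`, NOT joined inside the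
doubled box `Λ_{2n}` (so their pieces are distinct even after gluing through `Λ_{2n} ∖ Λ_n`), both
`a`-dense in `Λ_n`, and at least an `η`-fraction of the piece of `x'` lies within sup-distance `w`
of the piece of `x`. -/
def mixedPair (n w : ℕ) (a η : ℝ) : Set (BondConfig V3) :=
  {ω | ∃ x ∈ box 3 n, ∃ x' ∈ box 3 n,
    ω ∉ openConnIn (↑(box 3 (2 * n)) : Set V3) x x' ∧
    IsDenseIn a (box 3 n) ω x ∧ IsDenseIn a (box 3 n) ω x' ∧
    η * (pieceCard (box 3 n) ω x' : ℝ) ≤ (nearCard (box 3 n) ω x x' w : ℝ)}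

/-- The grid of cube centres of spacing `2w+1` covering `Λ_n` (the cubes `c + Λ_w`, `c` in the grid,
tile a neighbourhood of `Λ_n`). -/
def grid (n w : ℕ) : Finset V3 :=
  (box 3 (n / (2 * w + 1) + 1)).image fun z => ((2 * w + 1 : ℕ) : ℤ) • z

/-- **GRID TWO-ARMS COUNT (deterministic counting step).** On `mixedPair n w a η`, with an outer
radius `L ≤ n - 2w` so small that an `a`-dense piece cannot fit inside `c + Λ_L`
(`(2L+1)³ < a(2n+1)³`): every site `v` of the `w`-contact mass lies in a grid cube `c + Λ_w`; the
piece of `x` meets `c + Λ_{2w}` at some `u`; inside `c + Λ_L ⊆ Λ_{2n}` the clusters of `u` and `v`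
are disjoint (else `x ↔ x'` inside `Λ_{2n}`) and both reach `∂ⁱⁿ(c + Λ_L)` (the dense pieces are
larger than the ball); so `ω ∉ uniqZoneAt c (2w) L`. Each cube holds at most `(2w+1)³` such `v`,
whence the count. -/
def GridTwoArmsCount : Prop :=
  ∀ (n w L : ℕ) (a η : ℝ), 0 < a → 0 < η → 1 ≤ w → 2 * w ≤ L → L + 2 * w ≤ n →
    ((2 * L + 1 : ℝ)) ^ 3 < a * (2 * n + 1) ^ 3 →
    ∀ ω ∈ mixedPair n w a η,
      η * a * ((box 3 n).card : ℝ) / (2 * w + 1) ^ 3 ≤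
        (((grid n w).filter fun c => ω ∉ KozmaNitzan.uniqZoneAt c (2 * w) L).card : ℝ)

/-- **FIRST LEMMA OF THE LINE — UNIQUENESS-ZONE SEGREGATION at `p_c`.** For some `α > 0`
(any `α` of `dkt_prop1`; Cerf's Thm 1.2 gives the better `1/43.6` for site percolation), for all
densities `a > 0` and fractions `η > 0`: the probability that `Λ_n` contains a `⌊n^α⌋`-mixed pair of
`a`-dense pieces, distinct inside `Λ_{2n}`, tends to `0`. Proof from `GridTwoArmsCount` +
`dkt_prop1` + translation invariance (`KozmaNitzan.real_uniqZoneAt_eq`) + Markov: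
`P(mixedPair) · η a |Λ_n| / (2w+1)³ ≤ E #bad cubes = |grid| · P((uniqZone 2w L)ᶜ) ≤ C (n/w)³ L^{-α'}`
with `L = ⌊a^{1/3} n / 4⌋`, `2w ≤ ⌊L^{α'}⌋`. -/
def UniquenessZoneSegregation : Prop :=
  ∃ α : ℝ, 0 < α ∧ ∀ a η : ℝ, 0 < a → 0 < η →
    Tendsto (fun n : ℕ => (μ (criticalProbI 3)).real (mixedPair n ⌊(n : ℝ) ^ α⌋₊ a η))
      atTop (𝓝 0)

/-- The same with the RATE and UNIFORMLY in `p ∈ [δ, 1-δ]` (as `dkt_prop1` is uniform): useful for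
the crux's uniform-subcritical form (`Disproof.freeBoxSparse_iff_uniform_subcritical`) and for the
near-critical window above `p_c`. -/
def UniquenessZoneSegregationUniform : Prop :=
  ∃ α : ℝ, 0 < α ∧ ∀ δ a η : ℝ, 0 < δ → 0 < a → 0 < η → ∃ C : ℝ, ∃ n₀ : ℕ, ∀ n : ℕ, n₀ ≤ n →
    ∀ p : unitInterval, δ ≤ (p : ℝ) → (p : ℝ) ≤ 1 - δ →
      (μ p).real (mixedPair n ⌊(n : ℝ) ^ α⌋₊ a η) ≤ C * (n : ℝ) ^ (-α)

/-- **CONTACT-ZONE BOUND (quantitative by-product).** For pieces of `Λ_n` distinct inside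
`Λ_{2n}` (no density needed for the statement, density `a` of ONE piece needed in the proof to
force exits), the number of grid `w`-cubes, `w = ⌊n^α⌋`, met within distance `w` by BOTH a fixed
`a`-dense piece and another piece distinct from it in `Λ_{2n}` exceeds `n^{3-4α+ε}` only with
vanishing probability (first moment: `|grid| · n^{-α} / n^{3-4α+ε} → 0`). Typed as the complement
count of `uniqZoneAt` events over the grid, which dominates it. -/
def ContactZoneBound : Prop :=
  ∃ α : ℝ, 0 < α ∧ ∀ ε : ℝ, 0 < ε →
    Tendsto (fun n : ℕ => (μ (criticalProbI 3)).real
      {ω | (n : ℝ) ^ (3 - 4 * α + ε) ≤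
        (((grid n ⌊(n : ℝ) ^ α⌋₊).filter fun c =>
          ω ∉ KozmaNitzan.uniqZoneAt c (2 * ⌊(n : ℝ) ^ α⌋₊) (n / 2)).card : ℝ)})
      atTop (𝓝 0)

/-- **THE RESIDUAL the line would leave (typed for honesty, NOT claimed provable): no segregated
coexistence.** At `p_c`, given a giant scale (both halves of the hypothesis are what `stub_boost`
supplies in the jump world and what fails in the healthy world, where the statement is vacuous),
two `a`-dense pieces of `Λ_n` distinct inside `Λ_{2n}` — which by `UniquenessZoneSegregation` are
then `n^α`-segregated — do not coexist with non-vanishing probability. Equivalent to the crux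
modulo the landed stubs (as every residual of this crux must be); recorded so that triage can see
exactly where the line stops. -/
def NoSegregatedCoexistence : Prop :=
  ∀ a ε : ℝ, 0 < a → 0 < ε → ∃ N : ℕ, ∀ n : ℕ, N ≤ n →
    (1 - ε ≤ (μ (criticalProbI 3)).real {ω | ∃ x ∈ box 3 n, IsDenseIn a (box 3 n) ω x}) →
      (μ (criticalProbI 3)).real {ω | ∃ x ∈ box 3 n, ∃ x' ∈ box 3 n,
        ω ∉ openConnIn (↑(box 3 (2 * n)) : Set V3) x x' ∧
        IsDenseIn a (box 3 n) ω x ∧ IsDenseIn a (box 3 n) ω x'} < ε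

/-- Sanity: the in-tree inputs the line leans on exist with these names and shapes. -/
example : (1 : ℕ) ≤ 3 → ∀ {δ : ℝ}, 0 < δ →
    ∃ α : ℝ, 0 < α ∧ α < 1 ∧ ∃ n₁ : ℕ, ∀ n : ℕ, n₁ ≤ n → ∀ p : unitInterval, δ ≤ (p : ℝ) → (p : ℝ) ≤ 1 - δ →
      (bondPercolation (zdGraph 3) p).real (uniqZone (d := 3) ⌊(n : ℝ) ^ α⌋₊ n)ᶜ ≤ (n : ℝ) ^ (-α) :=
  fun hd _ hδ => AKN.dkt_prop1 hd hδ

example (p : unitInterval) (v : V3) (k n : ℕ) :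
    (μ p).real (KozmaNitzan.uniqZoneAt v k n) = (μ p).real (uniqZone k n) :=
  KozmaNitzan.real_uniqZoneAt_eq p v k n

example : Theses.PercNonProliferation.FreeBoxSparse ↔
    Tendsto (fun n : ℕ => (∑ x ∈ box 3 n, ∑ y ∈ box 3 n,
      (μ (criticalProbI 3)).real (openConnIn ↑(box 3 n) x y)) / ((box 3 n).card : ℝ) ^ 2)
      atTop (𝓝 0) := Iff.rfl

end Summit.CriticalPhenomena.PercolationContinuityZ3.Cruxes.FreeBoxSparse.SketchIdeator4

end
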